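import Mathlib
import HarnessLib
import HarnessLib.Audit
import Summits.NavierStokesRegularity.Statement
import Literature.Analysis.FluidPDE.VectorCalculus
import Literature.Analysis.FunctionSpaces.FourierSobolevNorm
import Literature.Analysis.FluidPDE.MildSolutions

/-!
Route: MinimalBlowupRigidity

CLOSED (superseded) 2026-08-15T13:10:12Z by planner-NavierStokesRegularity-route-NavierStokesRegularity-MinimalBlowupRigidit — reason: superseded:route-NavierStokesRegularity-MarginalTypeI — superseded by route-NavierStokesRegularity-MarginalTypeI — note: ROUTE-REPAIR CENSUS (planner route-repair, 2026-08-15). Items re-examined: 0104 Thesis (∀ν>0, rusinSverakRhoMaxPure ν = ⊤; the TARGET, mis-badged crux rank 0), 0106 Rigidity (no minimal blow-up datum; crux 2), 0107 RS fact, 0108 Kato→Clay, 0109 critical element (informal), 0105 Assembly. FINDINGS (f. The file is kept as the record of this route; refuted decls are indexed as negative knowledge (`ledger negatives`).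

# Route MinimalBlowupRigidity — NavierStokesRegularity (Clay A), positive side
(concentration-compactness / rigidity)

## Thesis X
In words: the Rusin–Šverák threshold in the full critical space Ḣ^{1/2}(ℝ³) is infinite for every
viscosity:
every divergence-free Ḣ^{1/2} datum has a global Kato (C_t L³) mild solution.
Lean (elaborates): ∀ ν : ℝ, 0 < ν → Literature.Analysis.FluidPDE.rusinSverakRhoMaxPure ν = ⊤

## Assembly X → NavierStokesRegularity
Schwartz divergence-free u₀ ∈ Ḣ^{1/2} ∩ L³ (represented by HomSobolev.ofFun) ⇒ HasGlobalKatoSolution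
ν u₀ ⇒ the global
Kato solution from a Clay datum is a Clay solution: jointly smooth (u,p) on ℝ³×[0,∞), bounded energy
(crux #4;
Kato1984 Thm 4, FujitaKato1964, LemarieRieusset2002 Ch. 15/27, energy equality for strong
solutions). Item #1 elaborates.

## Why this line
Imports the Kenig–Merle concentration-compactness/rigidity road map from critical dispersive PDE
(profile
decompositions in Ḣ^{1/2}/L³: arXiv:0908.3349 Kenig–Koch, arXiv:1012.0145 Gallagher–Koch–Planchon,
GKP2016) into
the ∀-datum problem via the in-tree Rusin–Šverák dichotomy
`Literature.Analysis.FluidPDE.rusin_sverak_minimal_blowup`: if ρ_max^pure(ν) < ⊤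
there is a MINIMAL blow-up datum (norm exactly ρ_max, no global Kato solution), and the set of such
data is compact
modulo translations and scalings. So ¬X produces a distinguished "critical element"; X follows from
a rigidity
theorem killing it. Distinct from TypeILiouville: the object to kill is minimal-in-norm rather than
Type-I-rescaled,
and compactness comes from minimality, not from a rate assumption. Numbers: ρ_max ≥ δν > 0
(FujitaKato1964);
no explicit lower bound on ρ_max(1) beyond the perturbative δ is in the tree; ρ_max = ⊤ ⇔ X.

## Ranked cruxes
#2 Rigidity (elaborates): for every ν>0 there is NO minimal blow-up datum —
   ¬∃ u₀ g, MemLp u₀ 3 ∧ g.Represents (complexify∘u₀) ∧ IsWeaklyDivFree u₀ ∧ ‖g‖ₑ = ρ_max^pure ν ∧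
¬HasGlobalKatoSolution ν u₀.
   With #3 this is equivalent to X. Hardest step.
#3 Fact: `Literature.Analysis.FluidPDE.rusin_sverak_minimal_blowup` (decl exists; Rusin–Šverák JFA
260 (2011) Thm 1.1).
#4 Assembly ingredient (elaborates): a global Kato solution from a smooth divergence-free rapidly
decaying datum yields
   a Clay-class solution (IsSmoothOnHalfSpace u, p ∧ IsNavierStokesSolution ν 0 u₀ u p ∧
HasBoundedEnergy u).
#5 Critical element (informal; needs_definition IsAlmostPeriodicModSymm): if ρ_max^pure ν < ⊤ then
some minimal blow-up
   datum generates a mild solution u_c on its maximal interval [0,T*) whose orbit {u_c(t)} is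
precompact in Ḣ^{1/2}
   modulo the scaling/translation group (Kenig–Merle compactness step; GKP profile decomposition
arXiv:1012.0145).
   Rigidity #2 is then attacked on u_c only (backward uniqueness, Liouville,
`necas_ruzicka_sverak`/`tsai_selfsimilar`).

## Kill criteria
- A minimal blow-up datum exhibited (¬#2) ⇒ ρ_max < ⊤ ⇒ some Ḣ^{1/2} datum blows up; NOT yet ¬A
(datum may be
  non-Schwartz) but the route closes; hand the datum to route Blowup.
- Proof that minimal elements need not enjoy any compactness beyond Rusin–Šverák's (kills #5, not
#2).

## NOT decomposed
The rigidity mechanism for u_c (which Liouville theorem; role of `TypeIDSSLiouvilleConjecture`);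
finite-energy
transcription (`RusinSverakQuestion`) — irrelevant here because X is stated in the pure space.

Rationale: Kenig–Merle style: X = rusinSverakRhoMaxPure ν = ⊤; ¬X yields a minimal blow-up datum (in-tree
Rusin–Šverák dichotomy) to be killed by rigidity.

History (route lifecycle, newest last):
- 2026-08-15T13:10:13Z · CLOSED superseded — superseded:route-NavierStokesRegularity-MarginalTypeI (planner-NavierStokesRegularity-route-NavierStokesRegularity-)

sub-problem: NavierStokesRegularity · status: closed(superseded) · opened planner-NavierStokesRegularity-Survey-0 2026-08-13T06:06:18Z · rev 0 · ledger route-NavierStokesRegularity-MinimalBlowupRigidity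
GENERATED by the gate from the ledger (D-0016/17). Provers cite these decls: `theorem foo : Summit.NavierStokesRegularity.NavierStokesRegularity.Theses.MinimalBlowupRigidity.<Decl> := …` in Summits/NavierStokesRegularity/NavierStokesRegularity/Theorems/<Name>.lean.
-/

namespace Summit.NavierStokesRegularity.NavierStokesRegularity.Theses.MinimalBlowupRigidity

open scoped BigOperators Topology Manifold Classical MeasureTheory ProbabilityTheory Matrix InnerProductSpace ComplexConjugate ContinuousMap
open Filter Set Function TopologicalSpace MeasureTheory

attribute [summit_statement] _root_.NavierStokesRegularity

open Literature.NS

/-- item stmt-NavierStokesRegularity-0104 · crux · rank 0 · closed · moot by None · by planner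
Every weakly divergence-free datum in Ḣ^{1/2}(ℝ³) has a global Kato (C_t L³) mild solution; phrased
with the in-tree threshold Literature.Analysis.FluidPDE.rusinSverakRhoMaxPure (Rusin–Šverák JFA 260
(2011) §1). [sources: FujitaKato1964, Kato1984, LemarieRieusset2002, GKP2016] -/
@[route_item "route-NavierStokesRegularity-MinimalBlowupRigidity"]
def MinimalBlowupRigidityThesis : Prop :=
  ∀ ν : ℝ, 0 < ν → Literature.Analysis.FluidPDE.rusinSverakRhoMaxPure ν = ⊤

/-- item stmt-NavierStokesRegularity-0106 · crux · rank 2 · closed · moot by None · by planner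
For every ν>0 there is no weakly divergence-free u₀ ∈ Ḣ^{1/2} with ‖u₀‖_{Ḣ^{1/2}} = ρ_max^pure(ν)
lacking a global Kato solution. Together with
Literature.Analysis.FluidPDE.rusin_sverak_minimal_blowup (crux #3) equivalent to the thesis. Road
map: Kenig–Merle — a minimal element is almost periodic modulo scaling/translations (crux #5), then
a Liouville/backward-uniqueness rigidity theorem kills it (cf. Kenig–Koch arXiv:0908.3349,
Gallagher–Koch–Planchon arXiv:1012.0145 where this scheme reproves ESS). [sources: arXiv:0908.3349,
arXiv:1012.0145, GKP2016, Seregin2012] -/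
@[route_item "route-NavierStokesRegularity-MinimalBlowupRigidity"]
def MinimalBlowupRigidityRigidity : Prop :=
  ∀ ν : ℝ, 0 < ν → ¬ ∃ (u₀ : EuclideanSpace ℝ (Fin 3) → EuclideanSpace ℝ (Fin 3)) (g : Literature.Analysis.FunctionSpaces.HomSobolev (EuclideanSpace ℝ (Fin 3)) (EuclideanSpace ℂ (Fin 3)) (1 / 2 : ℝ)), MeasureTheory.MemLp u₀ 3 MeasureTheory.volume ∧ g.Represents (Literature.Analysis.FunctionSpaces.EuclideanSpace.complexify ∘ u₀) ∧ Literature.Analysis.FluidPDE.IsWeaklyDivFree u₀ ∧ (‖g‖ₑ : ENNReal) = Literature.Analysis.FluidPDE.rusinSverakRhoMaxPure ν ∧ ¬ Literature.Analysis.FluidPDE.HasGlobalKatoSolution ν u₀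

/-- item stmt-NavierStokesRegularity-0107 · support · rank 3 · closed · moot by None · by planner
Rusin–Šverák, JFA 260 (2011), Thm 1.1 (decl in Literature/Analysis/FluidPDE/MildSolutions.lean): if
ρ_max^pure(ν) < ∞ then the infimum of ‖u₀‖_{Ḣ^{1/2}} over data without global Kato solution is
attained (and the set of minimisers is compact modulo translations and scalings — not in the decl).
Expected Literature fact. [sources: FujitaKato1964, LemarieRieusset2002] -/
@[route_item "route-NavierStokesRegularity-MinimalBlowupRigidity"]
def MinimalBlowupRigidityRS : Prop :=
  Literature.Analysis.FluidPDE.rusin_sverak_minimal_blowup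

/-- item stmt-NavierStokesRegularity-0108 · support · rank 4 · closed · moot by None · by planner
If u₀ is smooth, divergence-free, rapidly decaying and has a global mild solution in C([0,∞);L³)
(Literature.Analysis.FluidPDE.HasGlobalKatoSolution), then there are jointly smooth (u,p) on
ℝ³×[0,∞) solving NS classically with u(0)=u₀ and sup_t ∫|u|² < ∞: parabolic smoothing of Kato
solutions (Kato 1984 Thm 4; Lemarié-Rieusset 2002 Ch. 15, 27), persistence of L² (energy equality
for strong solutions), pressure p = (−Δ)^{-1}∂ᵢ∂ⱼ(uᵢuⱼ) smooth. Standard; expected fact-level.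
[sources: Kato1984, FujitaKato1964, LemarieRieusset2002, Leray1934] -/
@[route_item "route-NavierStokesRegularity-MinimalBlowupRigidity"]
def MinimalBlowupRigidityKatoToClay : Prop :=
  ∀ ν : ℝ, 0 < ν → ∀ u₀ : EuclideanSpace ℝ (Fin 3) → EuclideanSpace ℝ (Fin 3), ContDiff ℝ (⊤ : ℕ∞) u₀ → Literature.Analysis.FluidPDE.NSWave0.IsDivFree u₀ → Literature.Analysis.FluidPDE.HasRapidSpatialDecay u₀ → Literature.Analysis.FluidPDE.HasGlobalKatoSolution ν u₀ → ∃ (u : ℝ → EuclideanSpace ℝ (Fin 3) → EuclideanSpace ℝ (Fin 3)) (p : ℝ → EuclideanSpace ℝ (Fin 3) → ℝ), Literature.Analysis.FluidPDE.IsSmoothOnHalfSpace u ∧ Literature.Analysis.FluidPDE.IsSmoothOnHalfSpace p ∧ Literature.Analysis.FluidPDE.IsNavierStokesSolution ν 0 u₀ u p ∧ Literature.Analysis.FluidPDE.HasBoundedEnergy u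

-- item stmt-NavierStokesRegularity-0109 · support · rank 5 · closed · moot by None · by planner — informal only, no Lean statement yet:
--   If ρ_max^pure(ν) < ⊤ then some minimal blow-up datum u₀ (as in rusin_sverak_minimal_blowup) has its
--   Kato solution u_c on the maximal interval [0,T*) with {u_c(t) : 0 ≤ t < T*} precompact in
--   Ḣ^{1/2}(ℝ³) modulo the group generated by translations x ↦ x + x₀ and NS scalings v ↦ λ v(λ·)
--   (Kenig–Merle compactness; profile decomposition for NS: Gallagher–Koch–Planchon arXiv:1012.0145,
--   Kenig–Koch arXiv:0908.3349). Lean lacks 'precompact modulo the symmetry group in Ḣ^{1/2}' for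
--   function-valued paths: definition requested. [sources: arXiv:1012.0145, arXiv:0908.3349,
--   BahouriCheminDanchin2011] [needs_def

/-- item stmt-NavierStokesRegularity-0105 · assembly · rank 1 · closed · moot by None · by planner
Clay datum u₀ (smooth, div-free, rapidly decaying) lies in Ḣ^{1/2} ∩ L³ and is represented by
HomSobolev.ofFun (Literature.Analysis.FunctionSpaces.HomSobolev.represents_ofFun); ρ_max^pure = ⊤
gives HasGlobalKatoSolution ν u₀ (hasGlobalKatoSolution_of_lt_rusinSverakRhoMaxPure); crux #4 turns
it into a Clay-class solution; unfold NavierStokesRegularity. May take (h :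
Literature.Analysis.FunctionSpaces.HomSobolev.represents_ofFun) and crux #4 as hypotheses. [sources:
Kato1984, LemarieRieusset2002, BahouriCheminDanchin2011] -/
@[route_item "route-NavierStokesRegularity-MinimalBlowupRigidity"]
def Assembly : Prop :=
  (∀ ν : ℝ, 0 < ν → Literature.Analysis.FluidPDE.rusinSverakRhoMaxPure ν = ⊤) → NavierStokesRegularity

end Summit.NavierStokesRegularity.NavierStokesRegularity.Theses.MinimalBlowupRigidity
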